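import Literature.Geometry.Lorentzian.CarterSuperradiantFarConstants
import Literature.Geometry.Lorentzian.CarterFluxBookkeeping
import HarnessLib

/-!
# Polynomial bookkeeping for the superradiant BF-stable cone kernel bound, II: the deep-barrier kernel
# constant is a monomial in one master variable
(namespace `Literature.Geometry.Lorentzian.Kerr`; pure real arithmetic.)

The constant of `Literature.Analysis.ODE.kernel_le_of_deep_barrier`,

  `K = 3P_u²/|σ| + 3P_v²/|ω| + 2P_uP_v/s + P_u(2Q₁R_β/s + 2P₁R_α/|σ|) + P_v(2Q₁R_β/|ω| + 2P₁R_α/s)`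
   `+ (2Q₁²R_β²/|ω| + 2R_m + 2P₁Q₁R_αR_β/s + 2P₁²R_α²/|σ|)`,  `s = √(|ω||σ|)`,

is bounded by `24·G⁵` as soon as every atom `P_u, P_v, P₁, Q₁, R_α, R_β, R_m, |σ|⁻¹, |ω|⁻¹, s⁻¹` is `≤ G`
(`G ≥ 1`), and in the superradiant BF-stable sector of Carter's equation (envelopes and rates of
`Kerr.superradiant_kernel_le`) every atom is `≤ G := (677 + 10⁴c_B⁗)·Y^109` for the flux-regime master
variable `Y` (`Kerr.coneMaster_bounds`, enlarged by `θ₁⁻¹ ≤ Y`):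

* `deepBarrierConstant_le_of_atoms` — `K ≤ 24G⁵`;
* `superradiantAtoms_le_pow` — the atom bounds from `|σ| ≤ |ω| ≤ Y`, `|σ|⁻¹, |ω|⁻¹, κ⁻¹, M, M⁻¹, (M²)⁻¹,
  θ₁⁻¹, Λ ≤ Y` (`farRadius_le_pow`, `farConstant_B4_le_pow`, `farEnvelope4_sq_le_pow`,
  `nearLength_le_pow`, `invZoneRate_le_pow`);
* `superradiantKernelConstant_le_pow` — consequently `K ≤ 24(677 + 10⁴c_B⁗)⁵·Y^545`.

No analysis enters. Near-extremal Kerr programme, crux `KappaExplicitWaveDecay`.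

## References
* M. Dafermos, I. Rodnianski, Y. Shlapentokh-Rothman, arXiv:1402.7034 = Ann. of Math. 183 (2016), §8
  (key `DafermosRodnianskiShlapentokhrothman2014`). Folklore bookkeeping.
-/

noncomputable section

namespace Literature.Geometry.Lorentzian

namespace Kerr

section Bookkeeping

/-- `a/b ≤ A·B` from `0 ≤ a ≤ A`, `0 < b`, `b⁻¹ ≤ B`. [folklore] -/
private theorem div_le_of_atoms {a b A B : ℝ} (ha0 : 0 ≤ a) (ha : a ≤ A) (hb : 0 < b) (hbi : b⁻¹ ≤ B) :
    a / b ≤ A * B := by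
  rw [div_eq_mul_inv]; exact mul_le_mul ha hbi (inv_nonneg.2 hb.le) (ha0.trans ha)

/-- **The deep-barrier kernel constant from atom bounds**: if `G ≥ 1` dominates
`P_u, P_v, P₁, Q₁, R_α, R_β ≥ 0`, `R_m` and `|σ|⁻¹, |ω|⁻¹, (√(|ω||σ|))⁻¹` (`σ, ω ≠ 0`), then `K ≤ 24G⁵`.
[folklore] -/
theorem deepBarrierConstant_le_of_atoms {G Pu Pv P₁ Q₁ Rα Rβ Rm σ ω : ℝ} (hG : 1 ≤ G)
    (hPu0 : 0 ≤ Pu) (hPu : Pu ≤ G) (hPv0 : 0 ≤ Pv) (hPv : Pv ≤ G) (hP₁0 : 0 ≤ P₁) (hP₁ : P₁ ≤ G)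
    (hQ₁0 : 0 ≤ Q₁) (hQ₁ : Q₁ ≤ G) (hRα0 : 0 ≤ Rα) (hRα : Rα ≤ G) (hRβ0 : 0 ≤ Rβ) (hRβ : Rβ ≤ G)
    (hRm : Rm ≤ G) (hσ : σ ≠ 0) (hσi : |σ|⁻¹ ≤ G) (hω : ω ≠ 0) (hωi : |ω|⁻¹ ≤ G)
    (hsi : (Real.sqrt (|ω| * |σ|))⁻¹ ≤ G) :
    3 * Pu ^ 2 / |σ| + 3 * Pv ^ 2 / |ω| + 2 * Pu * Pv / Real.sqrt (|ω| * |σ|) +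
        Pu * (2 * Q₁ * Rβ / Real.sqrt (|ω| * |σ|) + 2 * P₁ * Rα / |σ|) +
        Pv * (2 * Q₁ * Rβ / |ω| + 2 * P₁ * Rα / Real.sqrt (|ω| * |σ|)) +
        (2 * Q₁ ^ 2 * Rβ ^ 2 / |ω| + 2 * Rm + 2 * P₁ * Q₁ * (Rα * Rβ) / Real.sqrt (|ω| * |σ|) +
          2 * P₁ ^ 2 * Rα ^ 2 / |σ|) ≤ 24 * G ^ 5 := by
  have hG0 : 0 < G := by linarith
  have hσ' : 0 < |σ| := abs_pos.2 hσ
  have hω' : 0 < |ω| := abs_pos.2 hω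
  set s := Real.sqrt (|ω| * |σ|) with hs
  have hs0 : 0 < s := Real.sqrt_pos.2 (mul_pos hω' hσ')
  -- squares and products of atoms
  have hPu2 : Pu ^ 2 ≤ G ^ 2 := pow_le_pow_left₀ hPu0 hPu 2
  have hPv2 : Pv ^ 2 ≤ G ^ 2 := pow_le_pow_left₀ hPv0 hPv 2
  have hP₁2 : P₁ ^ 2 ≤ G ^ 2 := pow_le_pow_left₀ hP₁0 hP₁ 2
  have hQ₁2 : Q₁ ^ 2 ≤ G ^ 2 := pow_le_pow_left₀ hQ₁0 hQ₁ 2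
  have hRα2 : Rα ^ 2 ≤ G ^ 2 := pow_le_pow_left₀ hRα0 hRα 2
  have hRβ2 : Rβ ^ 2 ≤ G ^ 2 := pow_le_pow_left₀ hRβ0 hRβ 2
  have hG1 : G ≤ G ^ 5 := le_self_pow₀ hG (by norm_num)
  have hG3 : G ^ 3 ≤ G ^ 5 := pow_le_pow_right₀ hG (by norm_num)
  have hG4 : G ^ 4 ≤ G ^ 5 := pow_le_pow_right₀ hG (by norm_num)
  -- the six summands
  have t1 : 3 * Pu ^ 2 / |σ| ≤ 3 * G ^ 3 := by
    calc 3 * Pu ^ 2 / |σ| ≤ (3 * G ^ 2) * G := div_le_of_atoms (by positivity) (by linarith) hσ' hσi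
      _ = 3 * G ^ 3 := by ring
  have t2 : 3 * Pv ^ 2 / |ω| ≤ 3 * G ^ 3 := by
    calc 3 * Pv ^ 2 / |ω| ≤ (3 * G ^ 2) * G := div_le_of_atoms (by positivity) (by linarith) hω' hωi
      _ = 3 * G ^ 3 := by ring
  have t3 : 2 * Pu * Pv / s ≤ 2 * G ^ 3 := by
    have h : 2 * Pu * Pv ≤ 2 * G * G := by
      have := mul_le_mul hPu hPv hPv0 hG0.le; linarith
    calc 2 * Pu * Pv / s ≤ (2 * G * G) * G := div_le_of_atoms (by positivity) h hs0 hsi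
      _ = 2 * G ^ 3 := by ring
  have hQR : Q₁ * Rβ ≤ G * G := mul_le_mul hQ₁ hRβ hRβ0 hG0.le
  have hPR : P₁ * Rα ≤ G * G := mul_le_mul hP₁ hRα hRα0 hG0.le
  have t4 : Pu * (2 * Q₁ * Rβ / s + 2 * P₁ * Rα / |σ|) ≤ 4 * G ^ 4 := by
    have h1 : 2 * Q₁ * Rβ / s ≤ (2 * (G * G)) * G :=
      div_le_of_atoms (by positivity) (by linarith) hs0 hsi
    have h2 : 2 * P₁ * Rα / |σ| ≤ (2 * (G * G)) * G :=
      div_le_of_atoms (by positivity) (by linarith) hσ' hσi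
    have h3 : 0 ≤ 2 * Q₁ * Rβ / s + 2 * P₁ * Rα / |σ| := by positivity
    calc Pu * (2 * Q₁ * Rβ / s + 2 * P₁ * Rα / |σ|) ≤ G * ((2 * (G * G)) * G + (2 * (G * G)) * G) :=
          mul_le_mul hPu (by linarith) h3 hG0.le
      _ = 4 * G ^ 4 := by ring
  have t5 : Pv * (2 * Q₁ * Rβ / |ω| + 2 * P₁ * Rα / s) ≤ 4 * G ^ 4 := by
    have h1 : 2 * Q₁ * Rβ / |ω| ≤ (2 * (G * G)) * G :=
      div_le_of_atoms (by positivity) (by linarith) hω' hωi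
    have h2 : 2 * P₁ * Rα / s ≤ (2 * (G * G)) * G :=
      div_le_of_atoms (by positivity) (by linarith) hs0 hsi
    have h3 : 0 ≤ 2 * Q₁ * Rβ / |ω| + 2 * P₁ * Rα / s := by positivity
    calc Pv * (2 * Q₁ * Rβ / |ω| + 2 * P₁ * Rα / s) ≤ G * ((2 * (G * G)) * G + (2 * (G * G)) * G) :=
          mul_le_mul hPv (by linarith) h3 hG0.le
      _ = 4 * G ^ 4 := by ring
  have t6 : 2 * Q₁ ^ 2 * Rβ ^ 2 / |ω| + 2 * Rm + 2 * P₁ * Q₁ * (Rα * Rβ) / s + 2 * P₁ ^ 2 * Rα ^ 2 / |σ| ≤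
      6 * G ^ 5 + 2 * G := by
    have hQR2 : Q₁ ^ 2 * Rβ ^ 2 ≤ G ^ 2 * G ^ 2 := mul_le_mul hQ₁2 hRβ2 (sq_nonneg _) (by positivity)
    have hPR2 : P₁ ^ 2 * Rα ^ 2 ≤ G ^ 2 * G ^ 2 := mul_le_mul hP₁2 hRα2 (sq_nonneg _) (by positivity)
    have hPQ : P₁ * Q₁ ≤ G * G := mul_le_mul hP₁ hQ₁ hQ₁0 hG0.le
    have hRR : Rα * Rβ ≤ G * G := mul_le_mul hRα hRβ hRβ0 hG0.le
    have hPQRR : P₁ * Q₁ * (Rα * Rβ) ≤ (G * G) * (G * G) :=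
      mul_le_mul hPQ hRR (by positivity) (by positivity)
    have h1 : 2 * Q₁ ^ 2 * Rβ ^ 2 / |ω| ≤ (2 * (G ^ 2 * G ^ 2)) * G :=
      div_le_of_atoms (by positivity) (by linarith [hQR2]) hω' hωi
    have h2 : 2 * P₁ * Q₁ * (Rα * Rβ) / s ≤ (2 * ((G * G) * (G * G))) * G :=
      div_le_of_atoms (by positivity) (by linarith [hPQRR]) hs0 hsi
    have h3 : 2 * P₁ ^ 2 * Rα ^ 2 / |σ| ≤ (2 * (G ^ 2 * G ^ 2)) * G :=
      div_le_of_atoms (by positivity) (by linarith [hPR2]) hσ' hσi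
    have e1 : (2 * (G ^ 2 * G ^ 2)) * G = 2 * G ^ 5 := by ring
    have e2 : (2 * ((G * G) * (G * G))) * G = 2 * G ^ 5 := by ring
    linarith [h1, h2, h3, hRm, e1, e2]
  have hG30 : 0 ≤ G ^ 3 := by positivity
  linarith [t1, t2, t3, t4, t5, t6, hG1, hG3, hG4]

variable {Y ω σ κ M θ₁ Λ Λ' rp : ℝ}

/-- `√x ≤ x + 1` for `x ≥ 0`. [folklore] -/
private theorem sqrt_le_add_one {x : ℝ} (hx : 0 ≤ x) : Real.sqrt x ≤ x + 1 := by
  rw [Real.sqrt_le_left (by linarith)]; nlinarith only [hx]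

/-- **Cap atoms**: `P_u = 2 + √2|σ|L ≤ 124802Y⁶`, `P₁ = √2|σ| ≤ 2Y`, `0 ≤ L ≤ 62400Y⁵`
(`L = (25/κ)log(2496Λ/(σ²M²))`), when `|σ| ≤ Y`, `κ⁻¹, Λ, |σ|⁻¹, (M²)⁻¹ ≤ Y`, `σ²M² ≤ Λ`, `1 ≤ Λ`, `Y ≥ 1`.
[folklore] -/
theorem superradiantCapAtoms_le_pow (hY : 1 ≤ Y) (hσ : σ ≠ 0) (hσY : |σ| ≤ Y) (hσi : |σ|⁻¹ ≤ Y)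
    (hκ : 0 < κ) (hκi : κ⁻¹ ≤ Y) (hM : 0 < M) (hM2i : (M ^ 2)⁻¹ ≤ Y) (hΛ1 : 1 ≤ Λ) (hΛY : Λ ≤ Y)
    (hσΛ : σ ^ 2 * M ^ 2 ≤ Λ) {L Pu P₁ : ℝ} (hLdef : L = 25 / κ * Real.log (2496 * Λ / (σ ^ 2 * M ^ 2)))
    (hPudef : Pu = 2 + Real.sqrt 2 * |σ| * L) (hP₁def : P₁ = Real.sqrt 2 * |σ|) :
    0 ≤ L ∧ L ≤ 62400 * Y ^ 5 ∧ Pu ≤ 124802 * Y ^ 6 ∧ P₁ ≤ 2 * Y := by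
  obtain ⟨hL0, hL⟩ := nearLength_le_pow hY hκ hκi hΛ1 hΛY hσ hσi hM hM2i hσΛ
  rw [← hLdef] at hL0 hL
  have h1 : Real.sqrt 2 ≤ 2 := by
    rw [Real.sqrt_le_left (by norm_num)]; norm_num
  refine ⟨hL0, hL, ?_, ?_⟩
  · have h2 : Real.sqrt 2 * |σ| * L ≤ 2 * Y * (62400 * Y ^ 5) :=
      mul_le_mul (mul_le_mul h1 hσY (abs_nonneg _) (by norm_num)) hL hL0 (by positivity)
    have h3 : (1:ℝ) ≤ Y ^ 6 := one_le_pow₀ hY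
    have e : 2 * Y * (62400 * Y ^ 5) = 124800 * Y ^ 6 := by ring
    rw [hPudef]; linarith only [h2, h3, e]
  · rw [hP₁def]; exact mul_le_mul h1 hσY (abs_nonneg _) (by norm_num)

/-- **Far atoms** at the start `ζ = θ₁M/4`: `0 ≤ R ≤ 12Y³`, `0 ≤ B`, `P_v ≤ (677 + 10⁴c_B⁗)Y^109`,
`Q₁ ≤ (3 + c_B⁗)Y^109` (`c_B⁗ = 64·678·(7·10⁴)¹⁶`), when `|ω|, |ω|⁻¹, Λ, M, M⁻¹, (M²)⁻¹, θ₁⁻¹ ≤ Y`,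
`0 < θ₁ ≤ 1`, `1 ≤ Λ`, `Y ≥ 1`. [folklore] -/
theorem superradiantFarAtoms_le_pow (hY : 1 ≤ Y) (hω : ω ≠ 0) (hωY : |ω| ≤ Y) (hωi : |ω|⁻¹ ≤ Y)
    (hM : 0 < M) (hMY : M ≤ Y) (hMi : M⁻¹ ≤ Y) (hM2i : (M ^ 2)⁻¹ ≤ Y) (hθ₁ : 0 < θ₁) (hθ₁1 : θ₁ ≤ 1)
    (hθ₁i : θ₁⁻¹ ≤ Y) (hΛ1 : 1 ≤ Λ) (hΛY : Λ ≤ Y) {R B Pv Q₁ : ℝ}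
    (hRdef : R = max (7 * M) (max (Real.sqrt (12 * Λ) / |ω|) (1 / (M * ω ^ 2))))
    (hBdef : B = ((ω ^ 2 + 6 * Λ / M ^ 2) / (θ₁ / (100 * M)) ^ 2) ^ 16 *
      Real.exp (2 * (θ₁ / (100 * M)) * (50 * M ^ 2 / (θ₁ * M / 4))) *
      ((θ₁ / (100 * M)) ^ 2 * (2 + 2 * |ω| * R) ^ 2 + 2 * ω ^ 2))
    (hPvdef : Pv = Real.sqrt ((2 + 2 * |ω| * R) ^ 2 + B / (θ₁ / (100 * M)) ^ 2))
    (hQ₁def : Q₁ = Real.sqrt (2 * ω ^ 2 + B)) :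
    0 ≤ R ∧ R ≤ 12 * Y ^ 3 ∧ 0 ≤ B ∧ Pv ≤ (677 + 1e4 * (64 * 678 * (7e4) ^ 16)) * Y ^ 109 ∧
      Q₁ ≤ (3 + 64 * 678 * (7e4) ^ 16) * Y ^ 109 := by
  have hω' : 0 < |ω| := abs_pos.2 hω
  have hR0 : 0 ≤ R := by rw [hRdef]; exact le_trans (by positivity) (le_max_left _ _)
  have hR : R ≤ 12 * Y ^ 3 := by rw [hRdef]; exact farRadius_le_pow hY hΛ1 hΛY hMY hMi hω' hωi
  have hB : B ≤ 64 * 678 * (7e4) ^ 16 * Y ^ 105 := by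
    rw [hBdef]
    exact farConstant_B4_le_pow hY hM hθ₁ hθ₁1 hωY hΛY (by linarith) hM2i hθ₁i hMY hR0 hR
  have hB0 : 0 ≤ B := by rw [hBdef]; positivity
  obtain ⟨hPv2, hQ₁2⟩ := farEnvelope4_sq_le_pow hY hM hθ₁ hθ₁1 hωY hM2i hθ₁i hMY hR0 hR hB
  set cB : ℝ := 64 * 678 * (7e4) ^ 16 with hcB
  have hcB0 : (0:ℝ) ≤ cB := by rw [hcB]; norm_num
  clear_value cB
  have hY109 : (1:ℝ) ≤ Y ^ 109 := one_le_pow₀ hY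
  refine ⟨hR0, hR, hB0, ?_, ?_⟩
  · have hE0 : 0 ≤ (2 + 2 * |ω| * R) ^ 2 + B / (θ₁ / (100 * M)) ^ 2 := by positivity
    have h1 : Pv ≤ (2 + 2 * |ω| * R) ^ 2 + B / (θ₁ / (100 * M)) ^ 2 + 1 := by
      rw [hPvdef]; exact sqrt_le_add_one hE0
    have e : (677 + 1e4 * cB) * Y ^ 109 = (676 + 1e4 * cB) * Y ^ 109 + Y ^ 109 := by ring
    linarith only [h1, hPv2, hY109, e]
  · have hE0 : 0 ≤ 2 * ω ^ 2 + B := by positivity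
    have h1 : Q₁ ≤ 2 * ω ^ 2 + B + 1 := by rw [hQ₁def]; exact sqrt_le_add_one hE0
    have h105 : Y ^ 105 ≤ Y ^ 109 := pow_le_pow_right₀ hY (by norm_num)
    have h105' : (2 + cB) * Y ^ 105 ≤ (2 + cB) * Y ^ 109 :=
      mul_le_mul_of_nonneg_left h105 (by linarith only [hcB0])
    have e : (3 + cB) * Y ^ 109 = (2 + cB) * Y ^ 109 + Y ^ 109 := by ring
    linarith only [h1, hQ₁2, hY109, h105', e]

/-- **Rate atoms**: with `L ≤ 62400Y⁵`, `R ≤ 12Y³`, `k = √(θ₁³Λ′/(3584r²))` (`0 < r ≤ 2M`, `1 ≤ Λ′`,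
`0 < θ₁`, `θ₁⁻¹, M ≤ Y`, `Y ≥ 1`): `0 < k`, `R_α = L + 2/k ≤ 62640Y⁵`,
`R_β = 200M/θ₁ + (7/5)R + 2/k ≤ 457Y⁵`, `R_m = L + 200M/θ₁ + (7/5)R + 4/k ≤ 63097Y⁵`. [folklore] -/
theorem superradiantRateAtoms_le_pow (hY : 1 ≤ Y) (hθ₁ : 0 < θ₁) (hθ₁i : θ₁⁻¹ ≤ Y) (hMY : M ≤ Y)
    (hrp : 0 < rp) (hrpM : rp ≤ 2 * M) (hΛ' : 1 ≤ Λ') {L R k Rα Rβ Rm : ℝ}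
    (hL : L ≤ 62400 * Y ^ 5) (hR : R ≤ 12 * Y ^ 3)
    (hkdef : k = Real.sqrt (θ₁ ^ 3 * Λ' / (3584 * rp ^ 2)))
    (hRαdef : Rα = L + 2 / k) (hRβdef : Rβ = 200 * M / θ₁ + 7 / 5 * R + 2 / k)
    (hRmdef : Rm = L + 200 * M / θ₁ + 7 / 5 * R + 4 / k) :
    0 < k ∧ Rα ≤ 62640 * Y ^ 5 ∧ Rβ ≤ 457 * Y ^ 5 ∧ Rm ≤ 63097 * Y ^ 5 := by
  have hM : 0 < M := by linarith
  have hk : 1 / k ≤ 120 * Y ^ 3 := by rw [hkdef]; exact invZoneRate_le_pow hY hrp hrpM hΛ' hθ₁ hθ₁i hMY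
  have hk0 : 0 < k := by rw [hkdef]; exact Real.sqrt_pos.2 (by positivity)
  have h2k : 2 / k ≤ 240 * Y ^ 3 := by
    have e : 2 / k = 2 * (1 / k) := by ring
    rw [e]; linarith only [hk]
  have h4k : 4 / k ≤ 480 * Y ^ 3 := by
    have e : 4 / k = 4 * (1 / k) := by ring
    rw [e]; linarith only [hk]
  have hMθ : 200 * M / θ₁ ≤ 200 * Y ^ 2 := by
    rw [div_eq_mul_inv]
    calc 200 * M * θ₁⁻¹ ≤ 200 * Y * Y := mul_le_mul (by linarith) hθ₁i (by positivity) (by positivity)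
      _ = 200 * Y ^ 2 := by ring
  have hY35 : Y ^ 3 ≤ Y ^ 5 := pow_le_pow_right₀ hY (by norm_num)
  have hY25 : Y ^ 2 ≤ Y ^ 5 := pow_le_pow_right₀ hY (by norm_num)
  have hY50 : (0:ℝ) ≤ Y ^ 5 := by positivity
  refine ⟨hk0, ?_, ?_, ?_⟩
  · rw [hRαdef]; linarith only [hL, h2k, hY35]
  · rw [hRβdef]; linarith only [hR, h2k, hMθ, hY35, hY25, hY50]
  · rw [hRmdef]; linarith only [hR, h4k, hMθ, hY35, hY25, hL, hY50]

/-- **The atoms of the superradiant kernel constant are powers of `Y`.** With `c_B⁗ = 64·678·(7·10⁴)¹⁶`,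
`G := (677 + 10⁴c_B⁗)·Y^109`, `η = θ₁/(100M)`, `R = max(7M, √(12Λ)/|ω|, 1/(Mω²))`,
`L = (25/κ)log(2496Λ/(σ²M²))`, `k = √(θ₁³Λ′/(3584 r²))`, `B` the far constant at `ζ = θ₁M/4`: if
`Y ≥ 1`, `|σ| ≤ |ω| ≤ Y`, `|σ|⁻¹, |ω|⁻¹, κ⁻¹, M, M⁻¹, (M²)⁻¹, θ₁⁻¹, Λ ≤ Y`, `1 ≤ Λ`, `1 ≤ Λ′`, `0 < θ₁ ≤ 1`,
`0 < r ≤ 2M`, `σ²M² ≤ Λ`, then `1 ≤ G` and each of `P_u = 2 + √2|σ|L`, `P_v = √((2 + 2|ω|R)² + B/η²)`,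
`P₁ = √2|σ|`, `Q₁ = √(2ω² + B)`, `R_α = L + 2/k`, `R_β = 200M/θ₁ + (7/5)R + 2/k`,
`R_m = L + 200M/θ₁ + (7/5)R + 4/k`, `|σ|⁻¹`, `|ω|⁻¹`, `(√(|ω||σ|))⁻¹` is `≤ G`. [folklore] -/
theorem superradiantAtoms_le_pow (hY : 1 ≤ Y) (hσ : σ ≠ 0) (hω : ω ≠ 0) (hσω : |σ| ≤ |ω|) (hωY : |ω| ≤ Y)
    (hσi : |σ|⁻¹ ≤ Y) (hωi : |ω|⁻¹ ≤ Y) (hκ : 0 < κ) (hκi : κ⁻¹ ≤ Y) (hM : 0 < M) (hMY : M ≤ Y)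
    (hMi : M⁻¹ ≤ Y) (hM2i : (M ^ 2)⁻¹ ≤ Y) (hθ₁ : 0 < θ₁) (hθ₁1 : θ₁ ≤ 1) (hθ₁i : θ₁⁻¹ ≤ Y)
    (hΛ1 : 1 ≤ Λ) (hΛY : Λ ≤ Y) (hΛ' : 1 ≤ Λ') (hrp : 0 < rp) (hrpM : rp ≤ 2 * M)
    (hσΛ : σ ^ 2 * M ^ 2 ≤ Λ) {R B L k Pu Pv P₁ Q₁ Rα Rβ Rm G : ℝ}
    (hRdef : R = max (7 * M) (max (Real.sqrt (12 * Λ) / |ω|) (1 / (M * ω ^ 2))))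
    (hBdef : B = ((ω ^ 2 + 6 * Λ / M ^ 2) / (θ₁ / (100 * M)) ^ 2) ^ 16 *
      Real.exp (2 * (θ₁ / (100 * M)) * (50 * M ^ 2 / (θ₁ * M / 4))) *
      ((θ₁ / (100 * M)) ^ 2 * (2 + 2 * |ω| * R) ^ 2 + 2 * ω ^ 2))
    (hLdef : L = 25 / κ * Real.log (2496 * Λ / (σ ^ 2 * M ^ 2)))
    (hkdef : k = Real.sqrt (θ₁ ^ 3 * Λ' / (3584 * rp ^ 2)))
    (hPudef : Pu = 2 + Real.sqrt 2 * |σ| * L)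
    (hPvdef : Pv = Real.sqrt ((2 + 2 * |ω| * R) ^ 2 + B / (θ₁ / (100 * M)) ^ 2))
    (hP₁def : P₁ = Real.sqrt 2 * |σ|) (hQ₁def : Q₁ = Real.sqrt (2 * ω ^ 2 + B))
    (hRαdef : Rα = L + 2 / k) (hRβdef : Rβ = 200 * M / θ₁ + 7 / 5 * R + 2 / k)
    (hRmdef : Rm = L + 200 * M / θ₁ + 7 / 5 * R + 4 / k)
    (hGdef : G = (677 + 1e4 * (64 * 678 * (7e4) ^ 16)) * Y ^ 109) :
    1 ≤ G ∧ Pu ≤ G ∧ Pv ≤ G ∧ P₁ ≤ G ∧ Q₁ ≤ G ∧ Rα ≤ G ∧ Rβ ≤ G ∧ Rm ≤ G ∧ |σ|⁻¹ ≤ G ∧ |ω|⁻¹ ≤ G ∧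
      (Real.sqrt (|ω| * |σ|))⁻¹ ≤ G := by
  have hY0 : 0 < Y := by linarith
  have hσY : |σ| ≤ Y := hσω.trans hωY
  obtain ⟨hL0, hL, aPu, aP₁⟩ := superradiantCapAtoms_le_pow hY hσ hσY hσi hκ hκi hM hM2i hΛ1 hΛY hσΛ hLdef
    hPudef hP₁def
  obtain ⟨hR0, hR, -, aPv, aQ₁⟩ := superradiantFarAtoms_le_pow hY hω hωY hωi hM hMY hMi hM2i hθ₁ hθ₁1 hθ₁i
    hΛ1 hΛY hRdef hBdef hPvdef hQ₁def
  obtain ⟨-, aRα, aRβ, aRm⟩ := superradiantRateAtoms_le_pow hY hθ₁ hθ₁i hMY hrp hrpM hΛ' hL hR hkdef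
    hRαdef hRβdef hRmdef
  set cB : ℝ := 64 * 678 * (7e4) ^ 16 with hcB
  set cG : ℝ := 677 + 1e4 * cB with hcG
  have hcB1 : (1e6:ℝ) ≤ cB := by rw [hcB]; norm_num
  have hcG1 : (1e6 : ℝ) ≤ cG := by rw [hcG]; linarith only [hcB1]
  clear_value cB cG
  have hYG : ∀ {c : ℝ} {i : ℕ}, 0 ≤ c → c ≤ cG → i ≤ 109 → c * Y ^ i ≤ G := by
    intro c i hc hcc hi
    rw [hGdef]
    calc c * Y ^ i ≤ c * Y ^ 109 := mul_le_mul_of_nonneg_left (pow_le_pow_right₀ hY hi) hc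
      _ ≤ cG * Y ^ 109 := mul_le_mul_of_nonneg_right hcc (by positivity)
  have hG1 : 1 ≤ G := by
    have := hYG (c := 1) (i := 0) zero_le_one (by linarith only [hcG1]) (by norm_num)
    simpa using this
  have hYG1 : Y ≤ G := by
    have := hYG (c := 1) (i := 1) zero_le_one (by linarith only [hcG1]) (by norm_num)
    simpa using this
  have as : (Real.sqrt (|ω| * |σ|))⁻¹ ≤ G := by
    have h1 : (Real.sqrt (|ω| * |σ|))⁻¹ ≤ Y := by
      rw [← Real.sqrt_inv, Real.sqrt_le_left hY0.le, mul_inv]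
      calc |ω|⁻¹ * |σ|⁻¹ ≤ Y * Y := mul_le_mul hωi hσi (by positivity) hY0.le
        _ = Y ^ 2 := (sq Y).symm
    exact h1.trans hYG1
  refine ⟨hG1, aPu.trans (hYG (by norm_num) (by linarith only [hcG1]) (by norm_num)),
    aPv.trans (hYG (by linarith only [hcG1]) le_rfl le_rfl), ?_,
    aQ₁.trans (hYG (by linarith only [hcB1]) (by rw [hcG]; linarith only [hcB1]) le_rfl),
    aRα.trans (hYG (by norm_num) (by linarith only [hcG1]) (by norm_num)),
    aRβ.trans (hYG (by norm_num) (by linarith only [hcG1]) (by norm_num)),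
    aRm.trans (hYG (by norm_num) (by linarith only [hcG1]) (by norm_num)), hσi.trans hYG1, hωi.trans hYG1,
    as⟩
  have h2 : P₁ ≤ 2 * Y ^ 1 := by rw [pow_one]; exact aP₁
  exact h2.trans (hYG (by norm_num) (by linarith only [hcG1]) (by norm_num))

/-- **The superradiant kernel constant is a monomial**: under the hypotheses of `superradiantAtoms_le_pow`,
`K ≤ 24(677 + 10⁴c_B⁗)⁵·Y^545`. [folklore] -/
theorem superradiantKernelConstant_le_pow (hY : 1 ≤ Y) (hσ : σ ≠ 0) (hω : ω ≠ 0) (hσω : |σ| ≤ |ω|)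
    (hωY : |ω| ≤ Y) (hσi : |σ|⁻¹ ≤ Y) (hωi : |ω|⁻¹ ≤ Y) (hκ : 0 < κ) (hκi : κ⁻¹ ≤ Y) (hM : 0 < M)
    (hMY : M ≤ Y) (hMi : M⁻¹ ≤ Y) (hM2i : (M ^ 2)⁻¹ ≤ Y) (hθ₁ : 0 < θ₁) (hθ₁1 : θ₁ ≤ 1)
    (hθ₁i : θ₁⁻¹ ≤ Y) (hΛ1 : 1 ≤ Λ) (hΛY : Λ ≤ Y) (hΛ' : 1 ≤ Λ') (hrp : 0 < rp) (hrpM : rp ≤ 2 * M)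
    (hσΛ : σ ^ 2 * M ^ 2 ≤ Λ) {R B L k Pu Pv P₁ Q₁ Rα Rβ Rm : ℝ}
    (hRdef : R = max (7 * M) (max (Real.sqrt (12 * Λ) / |ω|) (1 / (M * ω ^ 2))))
    (hBdef : B = ((ω ^ 2 + 6 * Λ / M ^ 2) / (θ₁ / (100 * M)) ^ 2) ^ 16 *
      Real.exp (2 * (θ₁ / (100 * M)) * (50 * M ^ 2 / (θ₁ * M / 4))) *
      ((θ₁ / (100 * M)) ^ 2 * (2 + 2 * |ω| * R) ^ 2 + 2 * ω ^ 2))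
    (hLdef : L = 25 / κ * Real.log (2496 * Λ / (σ ^ 2 * M ^ 2)))
    (hkdef : k = Real.sqrt (θ₁ ^ 3 * Λ' / (3584 * rp ^ 2)))
    (hPudef : Pu = 2 + Real.sqrt 2 * |σ| * L)
    (hPvdef : Pv = Real.sqrt ((2 + 2 * |ω| * R) ^ 2 + B / (θ₁ / (100 * M)) ^ 2))
    (hP₁def : P₁ = Real.sqrt 2 * |σ|) (hQ₁def : Q₁ = Real.sqrt (2 * ω ^ 2 + B))
    (hRαdef : Rα = L + 2 / k) (hRβdef : Rβ = 200 * M / θ₁ + 7 / 5 * R + 2 / k)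
    (hRmdef : Rm = L + 200 * M / θ₁ + 7 / 5 * R + 4 / k) :
    3 * Pu ^ 2 / |σ| + 3 * Pv ^ 2 / |ω| + 2 * Pu * Pv / Real.sqrt (|ω| * |σ|) +
        Pu * (2 * Q₁ * Rβ / Real.sqrt (|ω| * |σ|) + 2 * P₁ * Rα / |σ|) +
        Pv * (2 * Q₁ * Rβ / |ω| + 2 * P₁ * Rα / Real.sqrt (|ω| * |σ|)) +
        (2 * Q₁ ^ 2 * Rβ ^ 2 / |ω| + 2 * Rm + 2 * P₁ * Q₁ * (Rα * Rβ) / Real.sqrt (|ω| * |σ|) +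
          2 * P₁ ^ 2 * Rα ^ 2 / |σ|) ≤
      24 * (677 + 1e4 * (64 * 678 * (7e4) ^ 16)) ^ 5 * Y ^ 545 := by
  obtain ⟨hG1, aPu, aPv, aP₁, aQ₁, aRα, aRβ, aRm, aσ, aω, as⟩ := superradiantAtoms_le_pow hY hσ hω hσω hωY
    hσi hωi hκ hκi hM hMY hMi hM2i hθ₁ hθ₁1 hθ₁i hΛ1 hΛY hΛ' hrp hrpM hσΛ hRdef hBdef hLdef hkdef hPudef hPvdef
    hP₁def hQ₁def hRαdef hRβdef hRmdef rfl
  obtain ⟨hL0, -, -, -⟩ := superradiantCapAtoms_le_pow hY hσ (hσω.trans hωY) hσi hκ hκi hM hM2i hΛ1 hΛY hσΛ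
    hLdef hPudef hP₁def
  obtain ⟨hR0, -, hB0, -, -⟩ := superradiantFarAtoms_le_pow hY hω hωY hωi hM hMY hMi hM2i hθ₁ hθ₁1 hθ₁i
    hΛ1 hΛY hRdef hBdef hPvdef hQ₁def
  have hk0 : 0 < k := by rw [hkdef]; exact Real.sqrt_pos.2 (by positivity)
  set G := (677 + 1e4 * (64 * 678 * (7e4) ^ 16)) * Y ^ 109 with hG
  have hPu0 : 0 ≤ Pu := by rw [hPudef]; positivity
  have hPv0 : 0 ≤ Pv := by rw [hPvdef]; exact Real.sqrt_nonneg _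
  have hP₁0 : 0 ≤ P₁ := by rw [hP₁def]; positivity
  have hQ₁0 : 0 ≤ Q₁ := by rw [hQ₁def]; exact Real.sqrt_nonneg _
  have hRα0 : 0 ≤ Rα := by rw [hRαdef]; positivity
  have hRβ0 : 0 ≤ Rβ := by rw [hRβdef]; positivity
  have key := deepBarrierConstant_le_of_atoms hG1 hPu0 aPu hPv0 aPv hP₁0 aP₁ hQ₁0 aQ₁ hRα0 aRα hRβ0 aRβ
    aRm hσ aσ hω aω as
  have e : G ^ 5 = (677 + 1e4 * (64 * 678 * (7e4) ^ 16)) ^ 5 * Y ^ 545 := by rw [hG, mul_pow]; ring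
  calc _ ≤ 24 * G ^ 5 := key
    _ = 24 * (677 + 1e4 * (64 * 678 * (7e4) ^ 16)) ^ 5 * Y ^ 545 := by rw [e]; ring

end Bookkeeping

end Kerr

end Literature.Geometry.Lorentzian

end
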